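import Mathlib.Analysis.Calculus.BumpFunction.InnerProduct
import Mathlib.Analysis.Calculus.BumpFunction.FiniteDimension
import Literature.Analysis.Fourier.GradientBoundSchwartz
import Literature.Analysis.Fourier.LpMultiplierSchwartz
import Literature.Analysis.Fourier.LpMultiplierDilation
import Literature.Analysis.Fourier.LpMultiplierSum
import HarnessLib

/-!
# Annular `Lᵖ` multiplier bounds from an `Ẇ^{1,p}` bound, uniformly under dilation (`1 ≤ p < ∞`,
# in particular `p = 1`)

For a bounded, entrywise measurable matrix symbol `M` on `ℝᵈ` with the homogeneous Sobolev
bound `HasGradientLpBoundWith p c M` (`Σⱼ ‖M(D)∂ⱼφ‖_p ≤ c Σⱼ ‖∂ⱼφ‖_p` on `C_c^∞`, the form of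
[Rauch1986, (5) p. 483]) this file PROVES (`HasGradientLpBoundWith.isLpMultiplierWith_annular`):
for every smooth `η` supported in the annulus `1/4 ≤ |ξ| ≤ 2` and every `t > 0`, the
frequency-localised symbol `η(ξ/t) M(ξ)` is an `Lᵖ` Fourier multiplier with ONE constant
`c · K_d · ‖𝓕⁻¹η‖_{L¹}`, independent of `t`.

This is elementary (no Riesz transforms, no interpolation) and therefore available at the
endpoint `p = 1`, where it replaces, in Rauch's argument, the passage "Interpolating, (5) is
valid for `Lᵖ`, `1 < p < 2` … `Dⱼ/|D|` is a bounded operator on `Lᵖ`" [Rauch1986, p. 483]: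
what Brenner's necessity theorem consumes is only a family of multipliers with one constant
LOCALLY near each point `ξ ≠ 0` [BrennerThomeeWahlbin1975, Ch. 5 §1, proof of Lemma 1.1:
"choose `χ ∈ C₀^∞(B)`"], and such local information at `p = 1` follows from (5) directly.

## The argument

Fix a smooth `χ` with `χ = 1` on `1/8 ≤ |ξ| ≤ 2`, `χ = 0` near `0` and off `|ξ| ≤ 4`
(`annulusChi`). For a Schwartz `f` put `g = 𝓕⁻¹(η(·/t) f̂)` (Schwartz; `‖g‖_p ≤ ‖𝓕⁻¹η‖₁‖f‖_p`
by Young, the constant being dilation invariant). Since `χ(·/t) = 1` on the support of `ĝ`,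
`g = Σⱼ ∂ⱼΦⱼ` with `Φ̂ⱼ = t⁻¹ w_j(ξ/t) ĝ`, `w_j = χ ξⱼ/(2πi|ξ|²) ∈ C_c^∞` (`chiPotential`); the
`Ẇ^{1,p}` bound on the Schwartz test functions `Φⱼ` (the tree's
`HasGradientLpBoundWith.eLpNorm_multiplierOp_partialDeriv_schwartz_le`) gives
`‖M(D)∂ⱼΦⱼ‖_p ≤ c Σ_l ‖∂_lΦⱼ‖_p`, and `∂_lΦⱼ = m_{lj}(·/t)(D) g` with the SCHWARTZ symbols
`m_{lj} = ξ_lξⱼχ/|ξ|²` (`chiProduct`), in `M_p` with the dilation-invariant constants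
`‖𝓕⁻¹m_{lj}‖₁` [BrennerThomeeWahlbin1975, Ch. 1 Thms 2.3, 2.8]. Summing,
`‖(η(·/t)M)(D)f‖_p = ‖M(D)g‖_p ≤ c Σⱼ Σ_l ‖𝓕⁻¹m_{lj}‖₁ ‖𝓕⁻¹η‖₁ ‖f‖_p`.

## References

* [Rauch1986] J. Rauch, Comm. Math. Phys. 106 (1986) 481–484, Proof of Theorem p. 483, (5)–(6).
* [BrennerThomeeWahlbin1975] P. Brenner, V. Thomée, L. B. Wahlbin, LNM 434 (1975), Ch. 1
  Thms 2.3, 2.8; Ch. 5 §1, proof of Lemma 1.1.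
-/

noncomputable section

open MeasureTheory FourierTransform Filter Topology Complex
open scoped SchwartzMap ENNReal NNReal ContDiff LineDeriv Real

namespace Literature.Analysis.Fourier

/-! ### Generic complements -/

section General

variable {V : Type*} [NormedAddCommGroup V] [InnerProductSpace ℝ V] [FiniteDimensional ℝ V]
  [MeasurableSpace V] [BorelSpace V] {ι κ : Type*} [Fintype ι] [Fintype κ]

/-- `(Σᵢ Nᵢ)(D) f = Σᵢ Nᵢ(D) f` when every `Nᵢ · 𝓕f` is integrable. [folklore] -/
theorem multiplierOp_finset_sum' {σ : Type*} (s : Finset σ) (N : σ → V → Matrix κ ι ℂ)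
    {f : V → ι → ℂ} (h : ∀ i ∈ s, Integrable (fun ξ => (N i ξ).mulVec (𝓕 f ξ))) :
    multiplierOp (∑ i ∈ s, N i) f = ∑ i ∈ s, multiplierOp (N i) f := by
  classical
  induction s using Finset.induction_on with
  | empty => simp [multiplierOp_zero_symbol]
  | insert a s ha ih =>
    have hs : ∀ i ∈ s, Integrable (fun ξ => (N i ξ).mulVec (𝓕 f ξ)) := fun i hi =>
      h i (Finset.mem_insert_of_mem hi)
    have hsum : Integrable (fun ξ => ((∑ i ∈ s, N i) ξ).mulVec (𝓕 f ξ)) := by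
      have : (fun ξ => ((∑ i ∈ s, N i) ξ).mulVec (𝓕 f ξ)) =
          fun ξ => ∑ i ∈ s, (N i ξ).mulVec (𝓕 f ξ) := by
        funext ξ
        rw [Finset.sum_apply, Matrix.sum_mulVec]
      rw [this]
      exact integrable_finsetSum _ hs
    rw [Finset.sum_insert ha, Finset.sum_insert ha,
      multiplierOp_add _ _ (h a (Finset.mem_insert_self a s)) hsum, ih hs]

/-- `(m•1)(D)f = 𝓕⁻¹(m · 𝓕f)`: a scalar symbol acting diagonally. [folklore] -/
theorem multiplierOp_smul_one_eq' [DecidableEq ι] (m : V → ℂ) (f : V → ι → ℂ) :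
    multiplierOp (fun ξ => m ξ • (1 : Matrix ι ι ℂ)) f = 𝓕⁻ (fun ξ => m ξ • 𝓕 f ξ) := by
  rw [multiplierOp_apply]
  congr 1
  funext ξ
  rw [Matrix.smul_mulVec, Matrix.one_mulVec]

end General

section Algebra

variable {V : Type*} [NormedAddCommGroup V] [InnerProductSpace ℝ V]

/-- A smooth function vanishing near the origin times a function smooth away from the origin is
smooth. [folklore] -/
theorem contDiff_mul_of_eq_zero_of_norm_lt' {χ g : V → ℂ} (hχ : ContDiff ℝ ∞ χ) {r : ℝ}
    (hr : 0 < r) (h0 : ∀ ξ, ‖ξ‖ < r → χ ξ = 0) (hg : ∀ ξ, ξ ≠ 0 → ContDiffAt ℝ ∞ g ξ) :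
    ContDiff ℝ ∞ (fun ξ => χ ξ * g ξ) := by
  refine contDiff_iff_contDiffAt.2 fun ξ => ?_
  by_cases hξ : ξ = 0
  · have hev : (fun ξ => χ ξ * g ξ) =ᶠ[𝓝 ξ] fun _ => (0 : ℂ) := by
      have hb : Metric.ball (0 : V) r ∈ 𝓝 ξ := by
        rw [hξ]
        exact Metric.ball_mem_nhds _ hr
      filter_upwards [hb] with ζ hζ
      rw [h0 ζ (by simpa using hζ), zero_mul]
    exact (contDiffAt_const (c := (0 : ℂ))).congr_of_eventuallyEq hev
  · exact hχ.contDiffAt.mul (hg ξ hξ)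

end Algebra

/-! ### The fixed annular cut-off `χ` and the symbols `w_j`, `m_{lj}` -/

section Symbols

variable {d : ℕ}

/-- Outer bump: `= 1` on `‖ξ‖ ≤ 2`, supported in `‖ξ‖ < 4`. [folklore] -/
def outerBump (d : ℕ) : ContDiffBump (0 : EuclideanSpace ℝ (Fin d)) := ⟨2, 4, two_pos, by norm_num⟩

/-- Inner bump: `= 1` on `‖ξ‖ ≤ 1/16`, supported in `‖ξ‖ < 1/8`. [folklore] -/
def innerBump (d : ℕ) : ContDiffBump (0 : EuclideanSpace ℝ (Fin d)) :=
  ⟨1 / 16, 1 / 8, by norm_num, by norm_num⟩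

/-- **The annular cut-off** `χ = θ_out - θ_in`: `χ = 1` on `1/8 ≤ ‖ξ‖ ≤ 2`, `χ = 0` on
`‖ξ‖ ≤ 1/16` and on `‖ξ‖ ≥ 4`. [folklore] -/
def annulusChi (d : ℕ) (ξ : EuclideanSpace ℝ (Fin d)) : ℂ :=
  (((outerBump d) ξ - (innerBump d) ξ : ℝ) : ℂ)

/-- Unfolding `annulusChi`. [folklore] -/
theorem annulusChi_apply (ξ : EuclideanSpace ℝ (Fin d)) :
    annulusChi d ξ = (((outerBump d) ξ - (innerBump d) ξ : ℝ) : ℂ) := rfl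

/-- `χ = 1` on the annulus `1/8 ≤ ‖ξ‖ ≤ 2`. [folklore] -/
theorem annulusChi_eq_one {ξ : EuclideanSpace ℝ (Fin d)} (h₁ : 1 / 8 ≤ ‖ξ‖) (h₂ : ‖ξ‖ ≤ 2) :
    annulusChi d ξ = 1 := by
  rw [annulusChi_apply, (outerBump d).one_of_mem_closedBall (by simpa [outerBump] using h₂),
    (innerBump d).zero_of_le_dist (by simpa [innerBump] using h₁)]
  simp

/-- `χ = 0` on the ball `‖ξ‖ < 1/16`. [folklore] -/
theorem annulusChi_eq_zero_of_norm_lt {ξ : EuclideanSpace ℝ (Fin d)} (h : ‖ξ‖ < 1 / 16) :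
    annulusChi d ξ = 0 := by
  rw [annulusChi_apply, (outerBump d).one_of_mem_closedBall (by simp [outerBump]; linarith),
    (innerBump d).one_of_mem_closedBall (by simpa [innerBump] using h.le)]
  simp

/-- `χ = 0` off the ball of radius `4`. [folklore] -/
theorem annulusChi_eq_zero_of_le_norm {ξ : EuclideanSpace ℝ (Fin d)} (h : 4 ≤ ‖ξ‖) :
    annulusChi d ξ = 0 := by
  rw [annulusChi_apply, (outerBump d).zero_of_le_dist (by simpa [outerBump] using h),
    (innerBump d).zero_of_le_dist (by simp [innerBump]; linarith)]
  simp

/-- `χ(0) = 0`. [folklore] -/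
theorem annulusChi_zero : annulusChi d 0 = 0 :=
  annulusChi_eq_zero_of_norm_lt (by simp)

/-- `|χ| ≤ 1`. [folklore] -/
theorem norm_annulusChi_le (ξ : EuclideanSpace ℝ (Fin d)) : ‖annulusChi d ξ‖ ≤ 1 := by
  rw [annulusChi_apply, Complex.norm_real, Real.norm_eq_abs, abs_le]
  constructor
  · linarith [(outerBump d).nonneg (x := ξ), (innerBump d).le_one (x := ξ)]
  · linarith [(innerBump d).nonneg (x := ξ), (outerBump d).le_one (x := ξ)]

/-- `χ` is smooth. [folklore] -/
theorem contDiff_annulusChi : ContDiff ℝ ∞ (annulusChi d) :=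
  ofRealCLM.contDiff.comp ((outerBump d).contDiff.sub (innerBump d).contDiff)

/-- `χ` is continuous. [folklore] -/
theorem continuous_annulusChi : Continuous (annulusChi d) := contDiff_annulusChi.continuous

/-- `χ` has compact support. [folklore] -/
theorem hasCompactSupport_annulusChi : HasCompactSupport (annulusChi d) := by
  refine HasCompactSupport.intro (isCompact_closedBall (0 : EuclideanSpace ℝ (Fin d)) 4)
    fun ξ hξ => annulusChi_eq_zero_of_le_norm ?_
  rw [Metric.mem_closedBall, dist_zero_right, not_le] at hξ
  exact hξ.le

/-- `w_j(ξ) = χ(ξ) ξⱼ/(2πi|ξ|²)`. [folklore] -/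
def chiPotential (j : Fin d) (ξ : EuclideanSpace ℝ (Fin d)) : ℂ :=
  annulusChi d ξ * (((ξ j / ‖ξ‖ ^ 2 : ℝ) : ℂ) * (2 * π * I)⁻¹)

/-- `m_{lj}(ξ) = (2πiξ_l) w_j(ξ) = ξ_lξⱼχ(ξ)/|ξ|²`. [folklore] -/
def chiProduct (l j : Fin d) (ξ : EuclideanSpace ℝ (Fin d)) : ℂ :=
  2 * π * I * (ξ l : ℂ) * chiPotential j ξ

/-- Unfolding `chiPotential`. [folklore] -/
theorem chiPotential_apply (j : Fin d) (ξ : EuclideanSpace ℝ (Fin d)) :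
    chiPotential j ξ = annulusChi d ξ * (((ξ j / ‖ξ‖ ^ 2 : ℝ) : ℂ) * (2 * π * I)⁻¹) := rfl

/-- Unfolding `chiProduct`. [folklore] -/
theorem chiProduct_apply (l j : Fin d) (ξ : EuclideanSpace ℝ (Fin d)) :
    chiProduct l j ξ = 2 * π * I * (ξ l : ℂ) * chiPotential j ξ := rfl

/-- `r_j(0) = 0`. [folklore] -/
theorem rieszSymbol_zero' (j : Fin d) : rieszSymbol j (0 : EuclideanSpace ℝ (Fin d)) = 0 := by
  simp [rieszSymbol]

/-- `m_{lj} = -χ r_l r_j` (`r_j = -iξⱼ/|ξ|` the Riesz symbols; an algebraic identity only). [folklore] -/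
theorem chiProduct_eq (l j : Fin d) (ξ : EuclideanSpace ℝ (Fin d)) :
    chiProduct l j ξ = rieszSymbol l ξ * (-annulusChi d ξ * rieszSymbol j ξ) := by
  by_cases hξ : ξ = 0
  · subst hξ
    simp [chiProduct_apply, rieszSymbol_zero']
  · have hr : (‖ξ‖ : ℂ) ≠ 0 := by exact_mod_cast norm_ne_zero_iff.2 hξ
    rw [chiProduct_apply, chiPotential_apply, rieszSymbol, rieszSymbol]
    push_cast
    field_simp
    ring_nf
    rw [I_sq]
    ring

/-- `Σⱼ m_{jj} = χ`. [folklore] -/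
theorem sum_chiProduct (ξ : EuclideanSpace ℝ (Fin d)) : ∑ j, chiProduct j j ξ = annulusChi d ξ := by
  by_cases hξ : ξ = 0
  · subst hξ
    simp [chiProduct_apply, annulusChi_zero]
  · simp_rw [chiProduct_eq]
    have : ∀ j, rieszSymbol j ξ * (-annulusChi d ξ * rieszSymbol j ξ)
        = -annulusChi d ξ * rieszSymbol j ξ ^ 2 := fun j => by ring
    simp_rw [this, ← Finset.mul_sum, sum_rieszSymbol_sq hξ]
    ring

/-- `|m_{lj}| ≤ 1`. [folklore] -/
theorem norm_chiProduct_le (l j : Fin d) (ξ : EuclideanSpace ℝ (Fin d)) : ‖chiProduct l j ξ‖ ≤ 1 := by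
  rw [chiProduct_eq, norm_mul, norm_mul, norm_neg]
  refine mul_le_one₀ (norm_rieszSymbol_le l ξ) (by positivity)
    (mul_le_one₀ (norm_annulusChi_le ξ) (norm_nonneg _) (norm_rieszSymbol_le j ξ))

/-- `w_j` is smooth. [folklore] -/
theorem contDiff_chiPotential (j : Fin d) : ContDiff ℝ ∞ (chiPotential (d := d) j) := by
  refine contDiff_mul_of_eq_zero_of_norm_lt' contDiff_annulusChi (r := 1 / 16) (by norm_num)
    (fun ξ hξ => annulusChi_eq_zero_of_norm_lt hξ) fun ξ hξ => ?_
  have h1 : ContDiffAt ℝ ∞ (fun ξ : EuclideanSpace ℝ (Fin d) => ξ j / ‖ξ‖ ^ 2) ξ :=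
    ((contDiff_euclidean.1 contDiff_id j).contDiffAt).div (contDiff_norm_sq ℝ).contDiffAt
      (pow_ne_zero 2 (norm_ne_zero_iff.2 hξ))
  exact (ofRealCLM.contDiff.comp_contDiffAt ξ h1).mul contDiffAt_const

/-- `m_{lj}` is smooth. [folklore] -/
theorem contDiff_chiProduct (l j : Fin d) : ContDiff ℝ ∞ (chiProduct (d := d) l j) :=
  (contDiff_const.mul (ofRealCLM.contDiff.comp (contDiff_euclidean.1 contDiff_id l))).mul
    (contDiff_chiPotential j)

/-- `w_j` has compact support. [folklore] -/
theorem hasCompactSupport_chiPotential (j : Fin d) : HasCompactSupport (chiPotential (d := d) j) :=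
  hasCompactSupport_annulusChi.mul_right

/-- `m_{lj}` has compact support. [folklore] -/
theorem hasCompactSupport_chiProduct (l j : Fin d) : HasCompactSupport (chiProduct (d := d) l j) := by
  rw [show chiProduct (d := d) l j = fun ξ => (2 * π * I * (ξ l : ℂ)) * chiPotential j ξ from rfl]
  exact (hasCompactSupport_chiPotential j).mul_left

/-- `w_j` has temperate growth. [folklore] -/
theorem hasTemperateGrowth_chiPotential (j : Fin d) : (chiPotential (d := d) j).HasTemperateGrowth :=
  (hasCompactSupport_chiPotential j).hasTemperateGrowth (contDiff_chiPotential j)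

/-- `m_{lj}` as a Schwartz function. [folklore] -/
def chiProductSchwartz (l j : Fin d) : 𝓢(EuclideanSpace ℝ (Fin d), ℂ) :=
  (hasCompactSupport_chiProduct l j).toSchwartzMap (contDiff_chiProduct l j)

/-- The Schwartz function is `m_{lj}`. [folklore] -/
@[simp] theorem coe_chiProductSchwartz (l j : Fin d) : ⇑(chiProductSchwartz (d := d) l j) = chiProduct l j :=
  rfl

/-- The `M_p` constant `‖𝓕⁻¹m_{lj}‖₁` of `m_{lj}`. [folklore] -/
def chiProductConst (d : ℕ) (l j : Fin d) : ℝ≥0 :=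
  (∫⁻ t, ‖(𝓕⁻ (chiProductSchwartz l j) : 𝓢(EuclideanSpace ℝ (Fin d), ℂ)) t‖ₑ).toNNReal

/-- **Dilates of `m_{lj}` are `Lᵖ` multipliers with the constant `‖𝓕⁻¹m_{lj}‖₁`**, `1 ≤ p < ∞`.
[cite: BrennerThomeeWahlbin1975, Ch. 1 Thms 2.3, 2.8] -/
theorem isLpMultiplierWith_chiProduct_comp_smul {k : ℕ} {p : ℝ≥0∞} (hp1 : 1 ≤ p) (hp : p ≠ ⊤)
    (l j : Fin d) {a : ℝ} (ha : a ≠ 0) :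
    IsLpMultiplierWith p (chiProductConst d l j)
      (fun ξ => chiProduct l j (a • ξ) • (1 : Matrix (Fin k) (Fin k) ℂ)) := by
  have h := (isLpMultiplierWith_smul_one_schwartz (ι := Fin k) (chiProductSchwartz l j) hp1 hp).comp_smul ha
  unfold chiProductConst
  simpa only [coe_chiProductSchwartz] using h

end Symbols

/-! ### The test functions and the decomposition `g = Σⱼ ∂ⱼΦⱼ` -/

section TestFunctions

variable {d k : ℕ}

/-- The dilated potential symbol `t⁻¹ w_j(ξ/t)` (temperate). [folklore] -/
def chiPotentialDil (t : ℝ) (j : Fin d) (ξ : EuclideanSpace ℝ (Fin d)) : ℂ :=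
  (t⁻¹ : ℝ) * chiPotential j (t⁻¹ • ξ)

/-- Unfolding `chiPotentialDil`. [folklore] -/
theorem chiPotentialDil_apply (t : ℝ) (j : Fin d) (ξ : EuclideanSpace ℝ (Fin d)) :
    chiPotentialDil t j ξ = (t⁻¹ : ℝ) * chiPotential j (t⁻¹ • ξ) := rfl

/-- The dilated potential symbol has temperate growth. [folklore] -/
theorem hasTemperateGrowth_chiPotentialDil (t : ℝ) (j : Fin d) :
    (chiPotentialDil (d := d) t j).HasTemperateGrowth := by
  have h1 : (fun ξ : EuclideanSpace ℝ (Fin d) => chiPotential j (t⁻¹ • ξ)).HasTemperateGrowth :=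
    (hasTemperateGrowth_chiPotential j).comp
      (t⁻¹ • ContinuousLinearMap.id ℝ (EuclideanSpace ℝ (Fin d))).hasTemperateGrowth
  exact (Function.HasTemperateGrowth.const _).mul h1

/-- `(2πiξ_l) · t⁻¹w_j(ξ/t) = m_{lj}(ξ/t)`. [folklore] -/
theorem deriv_mul_chiPotentialDil (t : ℝ) (l j : Fin d) (ξ : EuclideanSpace ℝ (Fin d)) :
    2 * π * I * (ξ l : ℂ) * chiPotentialDil t j ξ = chiProduct l j (t⁻¹ • ξ) := by
  rw [chiPotentialDil_apply, chiProduct_apply, PiLp.smul_apply, smul_eq_mul]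
  push_cast
  field_simp

/-- `ξ ↦ ⟨ξ, eⱼ⟩` has temperate growth. [folklore] -/
theorem hasTemperateGrowth_inner_single' (j : Fin d) :
    (fun x : EuclideanSpace ℝ (Fin d) => inner ℝ x (EuclideanSpace.single j (1 : ℝ))).HasTemperateGrowth := by
  fun_prop

/-- `⟨ξ, eⱼ⟩ = ξⱼ`. [folklore] -/
theorem inner_single_one_right' (ξ : EuclideanSpace ℝ (Fin d)) (j : Fin d) :
    inner ℝ ξ (EuclideanSpace.single j (1 : ℝ)) = ξ j := by
  rw [EuclideanSpace.inner_single_right]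
  simp

/-- `∂ⱼ` of a Schwartz map in the tree's sense (`partialDeriv`) is Mathlib's line derivative
`∂_{eⱼ}`. [folklore] -/
theorem partialDeriv_coe_schwartz' (j : Fin d) (Φ : 𝓢(EuclideanSpace ℝ (Fin d), Fin k → ℂ)) :
    partialDeriv j (⇑Φ) =
      ⇑(∂_{EuclideanSpace.single j (1 : ℝ)} Φ : 𝓢(EuclideanSpace ℝ (Fin d), Fin k → ℂ)) := by
  funext x
  rw [partialDeriv_apply, SchwartzMap.lineDerivOp_apply_eq_fderiv]

/-- `Φⱼ = 𝓕⁻¹(t⁻¹w_j(ξ/t) · 𝓕g)`, a Schwartz function. [folklore] -/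
def chiTestFunction (t : ℝ) (j : Fin d) (g : 𝓢(EuclideanSpace ℝ (Fin d), Fin k → ℂ)) :
    𝓢(EuclideanSpace ℝ (Fin d), Fin k → ℂ) :=
  𝓕⁻ (SchwartzMap.smulLeftCLM (Fin k → ℂ) (chiPotentialDil t j) (𝓕 g))

/-- **`∂_lΦⱼ = m_{lj}(·/t)(D) g`.** [folklore] -/
theorem coe_lineDerivOp_chiTestFunction (t : ℝ) (l j : Fin d)
    (g : 𝓢(EuclideanSpace ℝ (Fin d), Fin k → ℂ)) :
    ⇑(∂_{EuclideanSpace.single l (1 : ℝ)} (chiTestFunction t j g) :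
        𝓢(EuclideanSpace ℝ (Fin d), Fin k → ℂ)) =
      multiplierOp (fun ξ => chiProduct l j (t⁻¹ • ξ) • (1 : Matrix (Fin k) (Fin k) ℂ)) ⇑g := by
  rw [chiTestFunction, SchwartzMap.lineDerivOp_fourierInv_eq, multiplierOp_smul_one_eq',
    SchwartzMap.fourierInv_coe]
  congr 1
  funext ξ
  rw [smul_apply, SchwartzMap.smulLeftCLM_apply_apply (hasTemperateGrowth_inner_single' l),
    SchwartzMap.smulLeftCLM_apply_apply (hasTemperateGrowth_chiPotentialDil t j),
    SchwartzMap.fourier_coe, inner_single_one_right', RCLike.real_smul_eq_coe_smul (K := ℂ),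
    smul_smul, smul_smul]
  congr 1
  simpa using deriv_mul_chiPotentialDil t l j ξ

/-- **`M(D)∂ⱼΦⱼ = (m_{jj}(·/t)M)(D) g`.** [folklore] -/
theorem multiplierOp_partialDeriv_chiTestFunction {k' : ℕ}
    (M : EuclideanSpace ℝ (Fin d) → Matrix (Fin k') (Fin k) ℂ) (t : ℝ) (j : Fin d)
    (g : 𝓢(EuclideanSpace ℝ (Fin d), Fin k → ℂ)) :
    multiplierOp M (partialDeriv j ⇑(chiTestFunction t j g)) =
      multiplierOp (fun ξ => chiProduct j j (t⁻¹ • ξ) • M ξ) ⇑g := by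
  rw [partialDeriv_coe_schwartz', multiplierOp_apply, multiplierOp_apply]
  congr 1
  funext ξ
  rw [← SchwartzMap.fourier_coe, SchwartzMap.fourier_lineDerivOp_eq, chiTestFunction,
    FourierTransform.fourier_fourierInv_eq, smul_apply,
    SchwartzMap.smulLeftCLM_apply_apply (hasTemperateGrowth_inner_single' j),
    SchwartzMap.smulLeftCLM_apply_apply (hasTemperateGrowth_chiPotentialDil t j),
    SchwartzMap.fourier_coe, inner_single_one_right', RCLike.real_smul_eq_coe_smul (K := ℂ),
    smul_smul, smul_smul, Matrix.mulVec_smul, Matrix.smul_mulVec]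
  congr 1
  simpa using deriv_mul_chiPotentialDil t j j ξ

/-- The symbols `m_{jl}(·/t)M` are entrywise measurable. [folklore] -/
theorem measurable_chiProduct_smul {k' : ℕ} {M : EuclideanSpace ℝ (Fin d) → Matrix (Fin k') (Fin k) ℂ}
    (hM : ∀ a b, Measurable fun ξ => M ξ a b) (t : ℝ) (l j : Fin d) (a : Fin k') (b : Fin k) :
    Measurable fun ξ => (chiProduct l j (t⁻¹ • ξ) • M ξ) a b := by
  simp only [Matrix.smul_apply, smul_eq_mul]
  exact ((contDiff_chiProduct l j).continuous.comp (continuous_const_smul _)).measurable.mul (hM a b)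

/-- … and bounded by the bound of `M`. [folklore] -/
theorem norm_chiProduct_smul_le {k' : ℕ} {M : EuclideanSpace ℝ (Fin d) → Matrix (Fin k') (Fin k) ℂ}
    {C₀ : ℝ} (hC : ∀ ξ a b, ‖M ξ a b‖ ≤ C₀) (t : ℝ) (l j : Fin d) (ξ : EuclideanSpace ℝ (Fin d))
    (a : Fin k') (b : Fin k) : ‖(chiProduct l j (t⁻¹ • ξ) • M ξ) a b‖ ≤ C₀ := by
  rw [Matrix.smul_apply, smul_eq_mul, norm_mul]
  exact (mul_le_mul (norm_chiProduct_le l j _) (hC ξ a b) (norm_nonneg _) zero_le_one).trans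
    (by rw [one_mul])

/-- **`(χ(·/t)M)(D)g = Σⱼ M(D)∂ⱼΦⱼ`** (`χ = Σⱼ m_{jj}`). [folklore] -/
theorem multiplierOp_annulusChi_smul_eq_sum {k' : ℕ} {M : EuclideanSpace ℝ (Fin d) → Matrix (Fin k') (Fin k) ℂ}
    (hM : ∀ a b, Measurable fun ξ => M ξ a b) {C₀ : ℝ} (hC0 : 0 ≤ C₀) (hC : ∀ ξ a b, ‖M ξ a b‖ ≤ C₀)
    (t : ℝ) (g : 𝓢(EuclideanSpace ℝ (Fin d), Fin k → ℂ)) :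
    multiplierOp (fun ξ => annulusChi d (t⁻¹ • ξ) • M ξ) ⇑g =
      ∑ j, multiplierOp M (partialDeriv j ⇑(chiTestFunction t j g)) := by
  simp_rw [multiplierOp_partialDeriv_chiTestFunction M t]
  rw [← multiplierOp_finset_sum' _ _ fun j _ =>
    integrable_mulVec_fourier (measurable_chiProduct_smul hM t j j) hC0
      (norm_chiProduct_smul_le hC t j j) g]
  congr 1
  funext ξ
  rw [Finset.sum_apply]
  simp_rw [← Finset.sum_smul, sum_chiProduct]

end TestFunctions

/-! ### The theorem -/

section Annular

variable {d k k' : ℕ}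

/-- An admissible frequency cut-off: smooth and supported in the annulus `1/4 ≤ ‖ξ‖ ≤ 2`.
[folklore] -/
structure IsAnnularCutoff (η : EuclideanSpace ℝ (Fin d) → ℂ) : Prop where
  contDiff : ContDiff ℝ ∞ η
  norm_of_ne_zero : ∀ ξ, η ξ ≠ 0 → 1 / 4 ≤ ‖ξ‖ ∧ ‖ξ‖ ≤ 2

namespace IsAnnularCutoff

variable {η : EuclideanSpace ℝ (Fin d) → ℂ} (hη : IsAnnularCutoff η)
include hη

/-- An annular cut-off has compact support. [folklore] -/
theorem hasCompactSupport : HasCompactSupport η := by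
  refine HasCompactSupport.intro (isCompact_closedBall (0 : EuclideanSpace ℝ (Fin d)) 2) fun ξ hξ => ?_
  by_contra h
  rw [Metric.mem_closedBall, dist_zero_right] at hξ
  exact hξ (hη.norm_of_ne_zero ξ h).2

/-- An annular cut-off has temperate growth. [folklore] -/
theorem hasTemperateGrowth : η.HasTemperateGrowth :=
  hη.hasCompactSupport.hasTemperateGrowth hη.contDiff

/-- `χ = 1` on the support of an annular cut-off: `χ η = η`. [folklore] -/
theorem annulusChi_mul (ξ : EuclideanSpace ℝ (Fin d)) : annulusChi d ξ * η ξ = η ξ := by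
  by_cases h : η ξ = 0
  · rw [h, mul_zero]
  · obtain ⟨h1, h2⟩ := hη.norm_of_ne_zero ξ h
    rw [annulusChi_eq_one (by linarith) h2, one_mul]

/-- The annular cut-off as a Schwartz function. [folklore] -/
def toSchwartz : 𝓢(EuclideanSpace ℝ (Fin d), ℂ) := hη.hasCompactSupport.toSchwartzMap hη.contDiff

/-- The Schwartz function is `η`. [folklore] -/
@[simp] theorem coe_toSchwartz : ⇑hη.toSchwartz = η := rfl

/-- The `M_p` constant `‖𝓕⁻¹η‖₁`. [folklore] -/
def const : ℝ≥0 := (∫⁻ x, ‖(𝓕⁻ hη.toSchwartz : 𝓢(EuclideanSpace ℝ (Fin d), ℂ)) x‖ₑ).toNNReal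

/-- Dilates of `η` are `Lᵖ` multipliers with the constant `‖𝓕⁻¹η‖₁`, `1 ≤ p < ∞`.
[cite: BrennerThomeeWahlbin1975, Ch. 1 Thms 2.3, 2.8] -/
theorem isLpMultiplierWith_comp_smul {p : ℝ≥0∞} (hp1 : 1 ≤ p) (hp : p ≠ ⊤) {a : ℝ} (ha : a ≠ 0) :
    IsLpMultiplierWith p hη.const (fun ξ => η (a • ξ) • (1 : Matrix (Fin k) (Fin k) ℂ)) := by
  have h := (isLpMultiplierWith_smul_one_schwartz (ι := Fin k) hη.toSchwartz hp1 hp).comp_smul ha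
  unfold const
  simpa only [coe_toSchwartz] using h

end IsAnnularCutoff

/-- The constant `K_d = Σⱼ Σ_l ‖𝓕⁻¹m_{lj}‖₁` of the annular bound. [folklore] -/
def annularConst (d : ℕ) : ℝ≥0 := ∑ j : Fin d, ∑ l : Fin d, chiProductConst d l j

/-- **Annular multiplier bounds from the `Ẇ^{1,p}` bound, uniformly under dilation.** Let `M`
be a bounded, entrywise measurable matrix symbol on `ℝᵈ` with `HasGradientLpBoundWith p c M`,
`1 ≤ p < ∞`, and let `η` be smooth, supported in `1/4 ≤ ‖ξ‖ ≤ 2`. Then for every `t ≠ 0` the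
symbol `η(t⁻¹ξ)M(ξ)` is an `Lᵖ` multiplier with constant `c · K_d · ‖𝓕⁻¹η‖₁`, independent of
`t`. In particular at `p = 1`, from Rauch's (5): the multiplier `M` is `L¹`-bounded on every
dyadic frequency shell, uniformly in the shell. (The proof is the decomposition
`η(·/t)(D)f = Σⱼ ∂ⱼΦⱼ` described in the module docstring; it uses neither the Riesz transforms
nor interpolation.) [cite: Rauch1986, Proof of Theorem p. 483, (5)–(6)] -/
theorem HasGradientLpBoundWith.isLpMultiplierWith_annular {p : ℝ≥0∞} {c : ℝ≥0}
    {M : EuclideanSpace ℝ (Fin d) → Matrix (Fin k') (Fin k) ℂ} (hG : HasGradientLpBoundWith p c M)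
    (hM : ∀ a b, Measurable fun ξ => M ξ a b) {C₀ : ℝ≥0} (hC : ∀ ξ a b, ‖M ξ a b‖ ≤ C₀)
    (hp1 : 1 ≤ p) (hp : p ≠ ⊤) {η : EuclideanSpace ℝ (Fin d) → ℂ} (hη : IsAnnularCutoff η)
    {t : ℝ} (ht : t ≠ 0) :
    IsLpMultiplierWith p (c * annularConst d * hη.const) (fun ξ => η (t⁻¹ • ξ) • M ξ) := by
  have hC0 : (0 : ℝ) ≤ C₀ := C₀.coe_nonneg
  have ht' : t⁻¹ ≠ 0 := inv_ne_zero ht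
  -- measurability and bound of the localised symbol
  have hηc : Continuous fun ξ : EuclideanSpace ℝ (Fin d) => η (t⁻¹ • ξ) :=
    hη.contDiff.continuous.comp (continuous_const_smul _)
  obtain ⟨Bη, hBη⟩ : ∃ B : ℝ, ∀ ξ, ‖η ξ‖ ≤ B := by
    obtain ⟨x₀, hx₀⟩ := hη.contDiff.continuous.norm.exists_forall_ge_of_hasCompactSupport
      hη.hasCompactSupport.norm
    exact ⟨‖η x₀‖, hx₀⟩
  have hBη0 : 0 ≤ Bη := (norm_nonneg _).trans (hBη 0)
  have hMn : ∀ a b, Measurable fun ξ => (η (t⁻¹ • ξ) • M ξ) a b := fun a b => by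
    simp only [Matrix.smul_apply, smul_eq_mul]
    exact hηc.measurable.mul (hM a b)
  have hCn : ∀ ξ a b, ‖(η (t⁻¹ • ξ) • M ξ) a b‖ ≤ Bη * C₀ := fun ξ a b => by
    rw [Matrix.smul_apply, smul_eq_mul, norm_mul]
    exact mul_le_mul (hBη _) (hC ξ a b) (norm_nonneg _) hBη0
  refine ⟨fun f => integrable_mulVec_fourier hMn (mul_nonneg hBη0 hC0) hCn f, fun f => ?_⟩
  -- the localised input `g = 𝓕⁻¹(η(·/t) f̂)`
  set ηt : EuclideanSpace ℝ (Fin d) → ℂ := fun ξ => η (t⁻¹ • ξ) with hηt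
  have hηt_temp : ηt.HasTemperateGrowth :=
    hη.hasTemperateGrowth.comp (t⁻¹ • ContinuousLinearMap.id ℝ (EuclideanSpace ℝ (Fin d))).hasTemperateGrowth
  set g : 𝓢(EuclideanSpace ℝ (Fin d), Fin k → ℂ) := 𝓕⁻ (SchwartzMap.smulLeftCLM (Fin k → ℂ) ηt (𝓕 f))
    with hg
  have hĝ : ∀ ξ, 𝓕 (⇑g) ξ = ηt ξ • 𝓕 (⇑f) ξ := fun ξ => by
    rw [← SchwartzMap.fourier_coe, hg, FourierTransform.fourier_fourierInv_eq,
      SchwartzMap.smulLeftCLM_apply_apply hηt_temp, SchwartzMap.fourier_coe]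
  -- `(ηₜM)(D) f = (χₜM)(D) g`  (`χₜ ηₜ = ηₜ`)
  have hop : multiplierOp (fun ξ => η (t⁻¹ • ξ) • M ξ) ⇑f =
      multiplierOp (fun ξ => annulusChi d (t⁻¹ • ξ) • M ξ) ⇑g := by
    rw [multiplierOp_apply, multiplierOp_apply]
    congr 1
    funext ξ
    rw [hĝ]
    simp only [hηt]
    rw [Matrix.mulVec_smul, Matrix.smul_mulVec, Matrix.smul_mulVec, smul_smul,
      mul_comm (η (t⁻¹ • ξ)), hη.annulusChi_mul]
  -- `‖g‖_p ≤ ‖𝓕⁻¹η‖₁ ‖f‖_p`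
  have hgf : (⇑g : EuclideanSpace ℝ (Fin d) → Fin k → ℂ) =
      multiplierOp (fun ξ => η (t⁻¹ • ξ) • (1 : Matrix (Fin k) (Fin k) ℂ)) ⇑f := by
    rw [multiplierOp_smul_one_eq', hg, SchwartzMap.fourierInv_coe]
    congr 1
    funext ξ
    rw [SchwartzMap.smulLeftCLM_apply_apply hηt_temp, SchwartzMap.fourier_coe]
  have hg_le : eLpNorm (⇑g) p volume ≤ hη.const * eLpNorm (⇑f) p volume := by
    rw [hgf]
    exact (hη.isLpMultiplierWith_comp_smul (k := k) hp1 hp ht').bound f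
  -- each term `M(D)∂ⱼΦⱼ`
  have hterm : ∀ j, eLpNorm (multiplierOp M (partialDeriv j ⇑(chiTestFunction t j g))) p volume ≤
      (c : ℝ≥0∞) * (∑ l, (chiProductConst d l j : ℝ≥0∞)) * eLpNorm (⇑g) p volume := by
    intro j
    refine (hG.eLpNorm_multiplierOp_partialDeriv_schwartz_le hM hC hp1 hp (chiTestFunction t j g) j).trans ?_
    rw [mul_assoc, Finset.sum_mul]
    gcongr with l
    rw [partialDeriv_coe_schwartz', coe_lineDerivOp_chiTestFunction t]
    exact (isLpMultiplierWith_chiProduct_comp_smul hp1 hp l j ht').bound g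
  have hmeas : ∀ j, AEStronglyMeasurable (multiplierOp M (partialDeriv j ⇑(chiTestFunction t j g))) volume :=
    fun j => by
    rw [multiplierOp_partialDeriv_chiTestFunction M t]
    exact (continuous_fourierInv_of_integrable (integrable_mulVec_fourier
      (measurable_chiProduct_smul hM t j j) hC0 (norm_chiProduct_smul_le hC t j j) g)).aestronglyMeasurable
  rw [hop, multiplierOp_annulusChi_smul_eq_sum hM hC0 hC t g]
  calc eLpNorm (∑ j, multiplierOp M (partialDeriv j ⇑(chiTestFunction t j g))) p volume
      ≤ ∑ j, eLpNorm (multiplierOp M (partialDeriv j ⇑(chiTestFunction t j g))) p volume :=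
        eLpNorm_sum_le (fun j _ => hmeas j) hp1
    _ ≤ ∑ j, (c : ℝ≥0∞) * (∑ l, (chiProductConst d l j : ℝ≥0∞)) * eLpNorm (⇑g) p volume :=
        Finset.sum_le_sum fun j _ => hterm j
    _ = (c : ℝ≥0∞) * (annularConst d : ℝ≥0∞) * eLpNorm (⇑g) p volume := by
        rw [← Finset.sum_mul, ← Finset.mul_sum, annularConst]
        push_cast
        rfl
    _ ≤ (c : ℝ≥0∞) * (annularConst d : ℝ≥0∞) * (hη.const * eLpNorm (⇑f) p volume) := by
        gcongr
    _ = ((c * annularConst d * hη.const : ℝ≥0) : ℝ≥0∞) * eLpNorm (⇑f) p volume := by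
        push_cast
        ring

end Annular

end Literature.Analysis.Fourier

end
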